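import Literature.Topology.FourManifolds.PairSaddlePassage
import Mathlib.Topology.Order.MonotoneConvergence
import HarnessLib

/-!
# The saddle pieces cover everything between the minimum and `hi`, and overlap only within one saddle

Topic `Literature/Topology/FourManifolds` (support file for the two-field handle-extension
endgame of `stmt-SmoothPoincare4-15190`, after `PairSaddlePassage.lean`).  Everything here is
**proved**; no definitions.

Milnor, *Lectures on the h-cobordism theorem* (1965), Thm. 4.1 and proof of Thm. 3.12 (PDF
pp. 18, 22): a trajectory of a gradient-like field either crosses a slab or ends at a critical
point, and near a critical point the trajectories ending (starting) there are the stable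
(unstable) disc of the Milnor box.  For saddle data `Q` of a pair of basin settings this yields
the **covering lemma** of the two-field extension map: every point `x` with `g p₀ < g x < hi`
lies in the domain `A.dom` of the level conjugation, or in the domain of the exit piece or of
the entrance piece of some saddle (any positive widths), or is a saddle (`cover`):

* if the `ξ_A`-trajectory of `x` does not meet `L` it converges to a saddle `s`, is eventually on
  the stable disc of the box of `s`, and met the level `c - ε²` on the stable sphere — `x` is in
  the entrance domain of `s` (or `x = s`);
* if it meets `L` off the basin, its top comes from a saddle `s` along the unstable disc and the
  trajectory met `c + ε²` on the unstable sphere — `x` is in the exit domain of `s`.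

Moreover **pieces of different saddles do not overlap** (`eq_of_mem_dom_refExit_of_mem_dom_refExit`,
…, six cases): the reference points are unique level points of one trajectory and the chart
domains of the boxes are pairwise disjoint.

## References

* J. Milnor, *Lectures on the h-cobordism theorem* (1965), Def. 3.9, Thm. 4.1, proofs of
  Thms. 3.12–3.13 (PDF pp. 16–22). [MilnorHCobordism1965]
-/

open scoped Manifold ContDiff Topology
open Set Function Filter Metric

noncomputable section

namespace Literature.Topology.FourManifolds

open Cobordism FourManifolds.Flow

universe u

variable {n : ℕ} {W : Type u} [TopologicalSpace W] [T2Space W] [SecondCountableTopology W]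
  [CompactSpace W] [ChartedSpace (EuclideanHalfSpace (n + 1)) W] [IsManifold (𝓡∂ (n + 1)) ∞ W]

/-! ### Two model computations on the axes -/

/-- On the stable axis (`y⃗ = 0`, `x⃗ ≠ 0`) the model flow reaches any prescribed `|x⃗|² = A' > 0`. [cite: MilnorHCobordism1965, proof of Thm. 3.12 (PDF p. 18)] -/
private theorem exists_sqSumLT_milnorFlow_eq {m : ℕ} (k : ℕ) {u : EuclideanSpace ℝ (Fin m)}
    (ha : 0 < sqSumLT k u) (hb : sqSumGE k u = 0) {A' : ℝ} (hA : 0 < A') :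
    ∃ t : ℝ, sqSumLT k (milnorFlow k t u) = A' ∧ sqSumGE k (milnorFlow k t u) = 0 := by
  refine ⟨-(Real.log (A' / sqSumLT k u) / 2), ?_, by rw [sqSumGE_milnorFlow, hb, mul_zero]⟩
  rw [sqSumLT_milnorFlow, neg_neg, ← Real.exp_nat_mul]
  rw [show ((2 : ℕ) : ℝ) * (Real.log (A' / sqSumLT k u) / 2) = Real.log (A' / sqSumLT k u) by push_cast; ring,
    Real.exp_log (div_pos hA ha), div_mul_cancel₀ _ ha.ne']

/-- On the unstable axis (`x⃗ = 0`, `y⃗ ≠ 0`) the model flow reaches any prescribed `|y⃗|² = B' > 0`. [cite: MilnorHCobordism1965, proof of Thm. 3.12 (PDF p. 18)] -/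
private theorem exists_sqSumGE_milnorFlow_eq {m : ℕ} (k : ℕ) {u : EuclideanSpace ℝ (Fin m)}
    (ha : sqSumLT k u = 0) (hb : 0 < sqSumGE k u) {B' : ℝ} (hB : 0 < B') :
    ∃ t : ℝ, sqSumLT k (milnorFlow k t u) = 0 ∧ sqSumGE k (milnorFlow k t u) = B' := by
  refine ⟨Real.log (B' / sqSumGE k u) / 2, by rw [sqSumLT_milnorFlow, ha, mul_zero], ?_⟩
  rw [sqSumGE_milnorFlow, ← Real.exp_nat_mul]
  rw [show ((2 : ℕ) : ℝ) * (Real.log (B' / sqSumGE k u) / 2) = Real.log (B' / sqSumGE k u) by push_cast; ring,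
    Real.exp_log (div_pos hB hb), div_mul_cancel₀ _ hb.ne']

/-- `‖v‖² = |x⃗|² + |y⃗|²`, so a vector with `|x⃗|² + |y⃗|² < R²` has norm `< R` (`R ≥ 0`). [folklore] -/
private theorem norm_lt_of_sqSum_lt {m : ℕ} (k : ℕ) {v : EuclideanSpace ℝ (Fin m)} {R : ℝ} (hR : 0 ≤ R)
    (h : sqSumLT k v + sqSumGE k v < R ^ 2) : ‖v‖ < R := by
  rw [sqSumLT_add_sqSumGE] at h
  exact (pow_lt_pow_iff_left₀ (norm_nonneg _) hR two_ne_zero).1 h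

namespace BasinPair

namespace SaddleData

variable {g : W → ℝ} {ξA ξB : Π x : W, TangentSpace (𝓡∂ (n + 1)) x} {P : BasinPair g ξA ξB}
  (Q : P.SaddleData)

/-! ### A non-critical orbit on an axis is not at the centre -/

/-- A point of an orbit of a non-critical point is not the centre of a box: its coordinates are
not both on the axes' origin. [folklore] -/
theorem sqSum_pos_of_not_isMCriticalPt {s : SaddlePt n g} {x : W} (hxc : ¬ IsMCriticalPt (𝓡∂ (n + 1)) g x)
    (t : ℝ) (hsrc : P.A.θ (t, x) ∈ (Q.DA s).chart.source) :
    0 < sqSumLT (Q.DA s).k ((Q.DA s).coord (P.A.θ (t, x))) + sqSumGE (Q.DA s).k ((Q.DA s).coord (P.A.θ (t, x))) := by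
  rw [sqSumLT_add_sqSumGE]
  refine lt_of_le_of_ne (sq_nonneg _) fun h0 => ?_
  have hc0 : (Q.DA s).coord (P.A.θ (t, x)) = 0 := by
    have h1 : ‖(Q.DA s).coord (P.A.θ (t, x))‖ ^ 2 = 0 := h0.symm
    exact norm_eq_zero.1 (pow_eq_zero_iff two_ne_zero |>.1 h1)
  have heq : P.A.θ (t, x) = s.1 := by
    have h1 := (Q.DA s).pt_coord hsrc
    rw [hc0] at h1
    rw [← h1]; exact (Q.DA s).symm_add_zero
  exact hxc ((P.A.isMCriticalPt_θ_iff t x).1 (heq ▸ s.2.1))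

/-! ### The covering lemma -/

/-- **Case of a trajectory not meeting `L`**: a non-critical `x` above the minimum whose
`ξ_A`-trajectory does not meet `L` lies in the entrance domain of some saddle (any width
`δ > 0`). [cite: MilnorHCobordism1965, Thm. 4.1, proof of Thm. 3.12 (PDF pp. 18, 22)] -/
theorem exists_mem_dom_refEnt_of_not_hits {x : W} (hx : g x ∈ Ioo (g P.A.p₀) P.A.hi)
    (hxc : ¬ IsMCriticalPt (𝓡∂ (n + 1)) g x) (hnot : ¬ Hits P.A.θ g P.A.L x) {δ : ℝ} (hδ : 0 < δ) :
    ∃ s, x ∈ (Q.refEnt s δ).dom := by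
  have hε := Q.ε_pos
  -- the trajectory converges to a critical point `p` with `g x ≤ g p ≤ hi`
  obtain ⟨p, hp, hpI, hconv, -⟩ : ∃ p, IsMCriticalPt (𝓡∂ (n + 1)) g p ∧ g p ∈ Icc (g x) P.A.hi ∧
      Tendsto (fun t => P.A.θ (t, x)) atTop (𝓝 p) ∧ x ∈ stableSet (𝓡∂ (n + 1)) ξA p := by
    rcases P.A.preSlabFlow.exists_lt_or_exists_tendsto_atTop (x := x) (P.A.lo_lt_apply x).le with
      ⟨t, ht0, ht⟩ | h
    · -- the trajectory rises above `hi > L`: it meets `L`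
      exfalso
      rcases le_or_gt P.A.L (g x) with hLx | hxL
      · exact hnot (P.A.hits_L_of_L_le hLx hx.2.le)
      · have hcont : Continuous fun τ => g (P.A.θ (τ, x)) := P.A.continuous_apply_θ x
        obtain ⟨τ, -, hτ⟩ := intermediate_value_Icc ht0 hcont.continuousOn
          ⟨by rw [P.A.θ_zero]; exact hxL.le, (P.A.L_lt_hi.trans ht).le⟩
        exact hnot ⟨τ, hτ⟩
    · exact h
  -- `p` is a saddle `s`
  have hpne : p ≠ P.A.p₀ := fun h => by rw [h] at hpI; exact (lt_irrefl _ (hx.1.trans_le hpI.1))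
  set s : SaddlePt n g := ⟨p, hp, P.A.morseIndex_ne_zero hp hpne⟩ with hs
  have hps : g p = Q.c := Q.apply_eq_c s
  -- the trajectory is eventually on the stable disc of the box of `s`
  obtain ⟨T₀, hbox, hB⟩ := (Q.DA s).exists_mem_box_sqSumGE_eq_zero_of_tendsto P.A.isFlowOf_X (x := x) hconv
  set p₁ := P.A.θ (T₀, x) with hp₁
  set u := (Q.DA s).coord p₁ with hu
  have hA : 0 < sqSumLT (Q.DA s).k u := by
    have h := Q.sqSum_pos_of_not_isMCriticalPt hxc T₀ hbox.1
    rw [← hu, hB, add_zero] at h; exact h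
  have hAε : sqSumLT (Q.DA s).k u < Q.ε ^ 2 := by have h := hbox.2.1; rwa [Q.εA] at h
  have hp₁ball : p₁ ∈ (Q.DA s).chartBall (3 * (Q.DA s).ε) := by
    refine ⟨hbox.1, norm_lt_of_sqSum_lt (Q.DA s).k (by linarith [(Q.DA s).eps_pos]) ?_⟩
    rw [← hu, hB, add_zero, Q.εA]; nlinarith
  -- move along the stable axis to `|x⃗|² = ε²`, i.e. to the level `c - ε²`
  obtain ⟨t, htA, htB⟩ := exists_sqSumLT_milnorFlow_eq (Q.DA s).k hA hB (pow_pos hε 2)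
  have hnorm : ‖milnorFlow (Q.DA s).k t u‖ < 3 * (Q.DA s).ε := by
    refine norm_lt_of_sqSum_lt (Q.DA s).k (by linarith [(Q.DA s).eps_pos]) ?_
    rw [htA, htB, add_zero, Q.εA]; nlinarith
  set w := P.A.θ (t, p₁) with hw
  have hwball : w ∈ (Q.DA s).chartBall (3 * (Q.DA s).ε) := (Q.DA s).flow_mem_chartBall P.A.isSmoothFlow_X P.A.contMDiff_X hp₁ball hnorm
  have hwcoord : (Q.DA s).coord w = milnorFlow (Q.DA s).k t u := (Q.DA s).coord_flow P.A.isSmoothFlow_X P.A.contMDiff_X hp₁ball hnorm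
  have hwℓ : g w = Q.c - Q.ε ^ 2 := by
    rw [hw, (Q.DA s).apply_flow P.A.isSmoothFlow_X P.A.contMDiff_X hp₁ball hnorm, milnorQuadratic_eq, htA, htB, hps]; ring
  have hwU : w ∈ Q.Uent s δ := by
    refine ⟨by rw [Q.εA] at hwball; exact hwball, ?_⟩
    rw [hwcoord, htB]; exact hδ
  -- `w` is the level point of `x` at `c - ε²`
  have hwx : w = P.A.θ (t + T₀, x) := by rw [hw, hp₁, P.A.θ_add]
  have hxc' : g x < Q.c := by
    -- levels along the orbit are `≤ c`; equality at `x` would freeze the orbit at `x ≠ s`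
    have hgc : Continuous g := P.A.isMorseFunction.isMorse.contMDiff.continuous
    have hlim : Tendsto (fun τ => g (P.A.θ (τ, x))) atTop (𝓝 Q.c) := by rw [← hps]; exact (hgc.tendsto _).comp hconv
    have hle : ∀ τ, g (P.A.θ (τ, x)) ≤ Q.c := fun τ => (P.A.monotone_apply_θ x).ge_of_tendsto hlim τ
    refine lt_of_le_of_ne (by simpa [P.A.θ_zero] using hle 0) fun heq => ?_
    have hfix : ∀ τ, 0 ≤ τ → P.A.θ (τ, x) = x := fun τ hτ =>
      P.A.θ_eq_of_apply_eq hxc (P.A.apply_mem_slab hx.2)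
        (le_antisymm (heq ▸ hle τ) (by simpa [P.A.θ_zero] using P.A.monotone_apply_θ x hτ))
    have hconst : Tendsto (fun τ => P.A.θ (τ, x)) atTop (𝓝 x) :=
      tendsto_const_nhds.congr' (by filter_upwards [eventually_ge_atTop (0 : ℝ)] with τ hτ using (hfix τ hτ).symm)
    have := tendsto_nhds_unique hconv hconst
    exact hxc (this ▸ hp)
  refine ⟨s, Q.mem_dom_refEnt ⟨hx.1, hxc'⟩ ?_⟩
  have h1 : levelProj P.A.θ g (Q.c - Q.ε ^ 2) x = w := by
    rw [hwx] at hwℓ ⊢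
    exact P.levelProj_A_eq_θ hxc ⟨Q.apply_p₀_lt_c_sub_sq, (sub_lt_self _ Q.sq_pos).trans Q.c_lt_hi⟩ hwℓ
  rw [h1]; exact hwU

/-- **Case of a top off the basin**: a non-critical `x` above the minimum and below `hi` whose
`ξ_A`-trajectory meets `L` at a point off the basin lies in the exit domain of some saddle (any
width `δ > 0`). [cite: MilnorHCobordism1965, Def. 3.9, Thm. 4.1, proof of Thm. 3.12 (PDF pp. 16–22)] -/
theorem exists_mem_dom_refExit_of_top_not_mem {x : W} (hx : g x ∈ Ioo (g P.A.p₀) P.A.hi)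
    (hxc : ¬ IsMCriticalPt (𝓡∂ (n + 1)) g x) (hhit : Hits P.A.θ g P.A.L x) (htop : P.A.top x ∉ P.A.basin)
    {δ : ℝ} (hδ : 0 < δ) : ∃ s, x ∈ (Q.refExit s δ).dom := by
  have hε := Q.ε_pos
  set y := P.A.top x with hy
  have hyL : g y = P.A.L := P.A.apply_top hhit
  -- the backward orbit of `y` converges to a critical point `p ≠ p₀`
  obtain ⟨p, hp, -, hconv, hyp⟩ := P.A.exists_tendsto_atBot (x := y) (by rw [hyL]; exact P.A.L_lt_hi.le)
  have hpne : p ≠ P.A.p₀ := fun h => htop (by rw [BasinSetting.mem_basin_iff, ← h]; exact hyp)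
  set s : SaddlePt n g := ⟨p, hp, P.A.morseIndex_ne_zero hp hpne⟩ with hs
  have hps : g p = Q.c := Q.apply_eq_c s
  have hyc : ¬ IsMCriticalPt (𝓡∂ (n + 1)) g y := P.A.not_isMCriticalPt_of_eq_L hyL
  -- eventually on the unstable disc of the box of `s`
  obtain ⟨T₀, hbox, hA⟩ := (Q.DA s).exists_mem_box_sqSumLT_eq_zero_of_tendsto_atBot P.A.isFlowOf_X (x := y) hconv
  set p₁ := P.A.θ (T₀, y) with hp₁
  set u := (Q.DA s).coord p₁ with hu
  have hB : 0 < sqSumGE (Q.DA s).k u := by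
    have h := Q.sqSum_pos_of_not_isMCriticalPt hyc T₀ hbox.1
    rw [← hu, hA, zero_add] at h; exact h
  have hBε : sqSumGE (Q.DA s).k u < 4 * Q.ε ^ 2 := by have h := hbox.2.2; rwa [Q.εA] at h
  have hp₁ball : p₁ ∈ (Q.DA s).chartBall (3 * (Q.DA s).ε) := by
    refine ⟨hbox.1, norm_lt_of_sqSum_lt (Q.DA s).k (by linarith [(Q.DA s).eps_pos]) ?_⟩
    rw [← hu, hA, zero_add, Q.εA]; nlinarith
  -- move along the unstable axis to `|y⃗|² = ε²`, i.e. to the level `c + ε²`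
  obtain ⟨t, htA, htB⟩ := exists_sqSumGE_milnorFlow_eq (Q.DA s).k hA hB (pow_pos hε 2)
  have hnorm : ‖milnorFlow (Q.DA s).k t u‖ < 3 * (Q.DA s).ε := by
    refine norm_lt_of_sqSum_lt (Q.DA s).k (by linarith [(Q.DA s).eps_pos]) ?_
    rw [htA, htB, zero_add, Q.εA]; nlinarith
  set z := P.A.θ (t, p₁) with hz
  have hzball : z ∈ (Q.DA s).chartBall (3 * (Q.DA s).ε) := (Q.DA s).flow_mem_chartBall P.A.isSmoothFlow_X P.A.contMDiff_X hp₁ball hnorm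
  have hzcoord : (Q.DA s).coord z = milnorFlow (Q.DA s).k t u := (Q.DA s).coord_flow P.A.isSmoothFlow_X P.A.contMDiff_X hp₁ball hnorm
  have hzℓ : g z = Q.c + Q.ε ^ 2 := by
    rw [hz, (Q.DA s).apply_flow P.A.isSmoothFlow_X P.A.contMDiff_X hp₁ball hnorm, milnorQuadratic_eq, htA, htB, hps]; ring
  have hzU : z ∈ Q.Uexit s δ := by
    refine ⟨by rw [Q.εA] at hzball; exact hzball, ?_⟩
    rw [hzcoord, htA]; exact hδ
  -- `z` lies on the orbit of `x`
  have hzx : z = P.A.θ (t + T₀ + hittingTime P.A.θ g P.A.L x, x) := by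
    rw [hz, hp₁, hy, BasinSetting.top_def, P.A.θ_add, P.A.θ_add, add_assoc]
  -- `g x > c`: the backward orbit of `x` converges to `s`
  have hconvx : Tendsto (fun τ => P.A.θ (τ, x)) atBot (𝓝 p) := by
    have h := (P.A.tendsto_θ_atBot_iff (-hittingTime P.A.θ g P.A.L x) (x := y) (p := p)).2 hconv
    have hxy : P.A.θ (-hittingTime P.A.θ g P.A.L x, y) = x := P.A.θ_neg_hittingTime_top x
    rwa [hxy] at h
  have hxc' : Q.c < g x := by
    have hgc : Continuous g := P.A.isMorseFunction.isMorse.contMDiff.continuous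
    have hlim : Tendsto (fun τ => g (P.A.θ (τ, x))) atBot (𝓝 Q.c) := by rw [← hps]; exact (hgc.tendsto _).comp hconvx
    have hge : ∀ τ, Q.c ≤ g (P.A.θ (τ, x)) := fun τ => (P.A.monotone_apply_θ x).le_of_tendsto hlim τ
    refine lt_of_le_of_ne (by simpa [P.A.θ_zero] using hge 0) fun heq => ?_
    have hfix : ∀ τ, τ ≤ 0 → P.A.θ (τ, x) = x := fun τ hτ =>
      P.A.θ_eq_of_apply_eq hxc (P.A.apply_mem_slab hx.2)
        (le_antisymm (by simpa [P.A.θ_zero] using P.A.monotone_apply_θ x hτ) (heq ▸ hge τ))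
    have hconst : Tendsto (fun τ => P.A.θ (τ, x)) atBot (𝓝 x) :=
      tendsto_const_nhds.congr' (by filter_upwards [eventually_le_atBot (0 : ℝ)] with τ hτ using (hfix τ hτ).symm)
    have := tendsto_nhds_unique hconvx hconst
    exact hxc (this ▸ hp)
  refine ⟨s, Q.mem_dom_refExit ⟨hxc', hx.2⟩ ?_⟩
  have h1 : levelProj P.A.θ g (Q.c + Q.ε ^ 2) x = z := by
    rw [hzx] at hzℓ ⊢
    exact P.levelProj_A_eq_θ hxc ⟨Q.apply_p₀_lt_c.trans (lt_add_of_pos_right _ Q.sq_pos), Q.c_add_sq_lt_hi⟩ hzℓ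
  rw [h1]; exact hzU

/-- **The covering lemma.**  Every point strictly between the minimum level and `hi` lies in
`A.dom`, or in the exit domain or the entrance domain of some saddle (any positive widths), or
is a saddle. [cite: MilnorHCobordism1965, Thm. 4.1, proofs of Thms. 3.12–3.13 (PDF pp. 18–22)] -/
theorem cover {δ₂ δ₃ : ℝ} (hδ₂ : 0 < δ₂) (hδ₃ : 0 < δ₃) {x : W} (hx : g x ∈ Ioo (g P.A.p₀) P.A.hi) :
    x ∈ P.A.dom ∨ (∃ s, x ∈ (Q.refExit s δ₂).dom) ∨ (∃ s, x ∈ (Q.refEnt s δ₃).dom) ∨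
      ∃ s : SaddlePt n g, x = s.1 := by
  by_cases hxc : IsMCriticalPt (𝓡∂ (n + 1)) g x
  · have hne : x ≠ P.A.p₀ := fun h => by rw [h] at hx; exact lt_irrefl _ hx.1
    exact Or.inr (Or.inr (Or.inr ⟨⟨x, hxc, P.A.morseIndex_ne_zero hxc hne⟩, rfl⟩))
  by_cases hhit : Hits P.A.θ g P.A.L x
  · by_cases htop : P.A.top x ∈ P.A.basin
    · exact Or.inl ⟨hx.2, hhit, htop⟩
    · exact Or.inr (Or.inl (Q.exists_mem_dom_refExit_of_top_not_mem hx hxc hhit htop hδ₂))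
  · exact Or.inr (Or.inr (Or.inl (Q.exists_mem_dom_refEnt_of_not_hits hx hxc hhit hδ₃)))

/-! ### Pieces of different saddles do not overlap -/

/-- Two boxes whose chart domains share a point are the same saddle's. [folklore] -/
theorem eq_of_mem_source_of_mem_source {s s' : SaddlePt n g} {z : W} (hz : z ∈ (Q.DA s).chart.source)
    (hz' : z ∈ (Q.DA s').chart.source) : s = s' := by
  by_contra hne
  exact Set.disjoint_left.1 (Q.disjA s s' hne) hz hz'

/-- **Exit domains of different saddles are disjoint** (the reference point is the unique level
point at `c + ε²`). [folklore] -/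
theorem eq_of_mem_dom_refExit_of_mem_dom_refExit {s s' : SaddlePt n g} {δ δ' : ℝ} {x : W}
    (hx : x ∈ (Q.refExit s δ).dom) (hx' : x ∈ (Q.refExit s' δ').dom) : s = s' :=
  Q.eq_of_mem_source_of_mem_source hx.2.2.2.1.1 hx'.2.2.2.1.1

/-- **Entrance domains of different saddles are disjoint.** [folklore] -/
theorem eq_of_mem_dom_refEnt_of_mem_dom_refEnt {s s' : SaddlePt n g} {δ δ' : ℝ} {x : W}
    (hx : x ∈ (Q.refEnt s δ).dom) (hx' : x ∈ (Q.refEnt s' δ').dom) : s = s' :=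
  Q.eq_of_mem_source_of_mem_source hx.2.2.2.1.1 hx'.2.2.2.1.1

/-- **An entrance domain of width `≤ ε²` meets exit domains of its own saddle only** (the passage
from the entrance reference point exits inside the same box). [cite: MilnorHCobordism1965, proof of Thm. 3.13] -/
theorem eq_of_mem_dom_refEnt_of_mem_dom_refExit {s s' : SaddlePt n g} {δ δ' : ℝ} (hδ : δ ≤ Q.ε ^ 2) {x : W}
    (hx₃ : x ∈ (Q.refEnt s δ).dom) (hx₂ : x ∈ (Q.refExit s' δ').dom) : s = s' := by
  set w := (Q.refEnt s δ).ref x with hw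
  have hwU : w ∈ Q.Uent s δ := RefData.ref_mem_U hx₃
  have hwℓ : g w = Q.c - Q.ε ^ 2 := RefData.apply_ref hx₃
  have hb : 0 < sqSumGE (Q.DA s).k ((Q.DA s).coord w) := by
    refine lt_of_le_of_ne (sqSumGE_nonneg _ _) fun h0 => ?_
    have hnot := Q.not_hits_of_sqSumGE_eq_zero hwU.1 h0.symm (lt_add_of_pos_right _ Q.sq_pos)
    rw [hw, RefData.ref_def, refEnt_ℓ₀, P.A.hits_levelProj_iff] at hnot
    exact hnot hx₂.2.2.1
  obtain ⟨t, ht0, htℓ, -, hball, -⟩ := Q.exists_exit_of_mem_Uent hδ hwU hwℓ hb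
  have href₂ : (Q.refExit s' δ').ref x = P.A.θ (t, w) := by
    rw [RefData.ref_def, refExit_ℓ₀]
    have h1 : P.A.θ (t, w) = P.A.θ (t + hittingTime P.A.θ g (Q.c - Q.ε ^ 2) x, x) := by
      rw [← P.A.θ_add]; rfl
    rw [h1] at htℓ ⊢
    exact P.levelProj_A_eq_θ hx₂.2.1 ⟨Q.apply_p₀_lt_c.trans (lt_add_of_pos_right _ Q.sq_pos), Q.c_add_sq_lt_hi⟩ htℓ
  have h2 : P.A.θ (t, w) ∈ (Q.DA s').chart.source := by
    have h := (RefData.ref_mem_U hx₂ : (Q.refExit s' δ').ref x ∈ Q.Uexit s' δ').1.1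
    rwa [href₂] at h
  exact Q.eq_of_mem_source_of_mem_source (hball t ⟨ht0, le_rfl⟩).1 h2

/-- **A `ρ`-ball (`ρ ≤ ε`) meets exit domains of its own saddle only.** [cite: MilnorHCobordism1965, proof of Thm. 3.13] -/
theorem eq_of_mem_chartBall_of_mem_dom_refExit {s s' : SaddlePt n g} {ρ δ : ℝ} (hρ : ρ ≤ Q.ε) {x : W}
    (hxb : x ∈ (Q.DA s).chartBall ρ) (hx₂ : x ∈ (Q.refExit s' δ).dom) : s = s' := by
  have hx3 : x ∈ (Q.DA s).chartBall (3 * Q.ε) := ⟨hxb.1, by linarith [hxb.2, Q.ε_pos]⟩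
  have hb : 0 < sqSumGE (Q.DA s).k ((Q.DA s).coord x) := by
    refine lt_of_le_of_ne (sqSumGE_nonneg _ _) fun h0 => ?_
    exact Q.not_hits_of_sqSumGE_eq_zero hx3 h0.symm (lt_add_of_pos_right _ Q.sq_pos) hx₂.2.2.1
  obtain ⟨t, ht0, htℓ, -, hball, -⟩ := Q.exists_exit_of_mem_chartBall hρ hxb hb
  have href : (Q.refExit s' δ).ref x = P.A.θ (t, x) := by
    rw [RefData.ref_def, refExit_ℓ₀]
    exact P.levelProj_A_eq_θ hx₂.2.1 ⟨Q.apply_p₀_lt_c.trans (lt_add_of_pos_right _ Q.sq_pos), Q.c_add_sq_lt_hi⟩ htℓ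
  have h2 : P.A.θ (t, x) ∈ (Q.DA s').chart.source := by
    have h := (RefData.ref_mem_U hx₂ : (Q.refExit s' δ).ref x ∈ Q.Uexit s' δ).1.1
    rwa [href] at h
  exact Q.eq_of_mem_source_of_mem_source (hball t ⟨ht0, le_rfl⟩).1 h2

/-- **A `ρ`-ball (`ρ ≤ ε`) meets entrance domains of its own saddle only.** [cite: MilnorHCobordism1965, proof of Thm. 3.13] -/
theorem eq_of_mem_chartBall_of_mem_dom_refEnt {s s' : SaddlePt n g} {ρ δ : ℝ} (hρ : ρ ≤ Q.ε) {x : W}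
    (hxb : x ∈ (Q.DA s).chartBall ρ) (hx₃ : x ∈ (Q.refEnt s' δ).dom) : s = s' := by
  have ha : 0 < sqSumLT (Q.DA s).k ((Q.DA s).coord x) := by
    refine lt_of_le_of_ne (sqSumLT_nonneg _ _) fun h0 => ?_
    have hB : sqSumGE (Q.DA s).k ((Q.DA s).coord x) ≤ 4 * Q.ε ^ 2 := by
      have h1 := sqSumLT_add_sqSumGE (Q.DA s).k ((Q.DA s).coord x)
      have h2 : ‖(Q.DA s).coord x‖ ^ 2 ≤ Q.ε ^ 2 :=
        (pow_le_pow_left₀ (norm_nonneg _) hxb.2.le 2).trans (pow_le_pow_left₀ ((norm_nonneg _).trans hxb.2.le) hρ 2)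
      nlinarith [sqSumLT_nonneg (Q.DA s).k ((Q.DA s).coord x), pow_pos Q.ε_pos 2]
    exact Q.not_hits_of_sqSumLT_eq_zero hxb.1 h0.symm hB (sub_lt_self _ Q.sq_pos) hx₃.2.2.1
  obtain ⟨t, ht0, htℓ, -, hball, -⟩ := Q.exists_entrance_of_mem_chartBall hρ hxb ha
  have href : (Q.refEnt s' δ).ref x = P.A.θ (t, x) := by
    rw [RefData.ref_def, refEnt_ℓ₀]
    exact P.levelProj_A_eq_θ hx₃.2.1 ⟨Q.apply_p₀_lt_c_sub_sq, (sub_lt_self _ Q.sq_pos).trans Q.c_lt_hi⟩ htℓ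
  have h2 : P.A.θ (t, x) ∈ (Q.DA s').chart.source := by
    have h := (RefData.ref_mem_U hx₃ : (Q.refEnt s' δ).ref x ∈ Q.Uent s' δ).1.1
    rwa [href] at h
  exact Q.eq_of_mem_source_of_mem_source (hball t ⟨le_rfl, ht0⟩).1 h2

/-- **`ρ`-balls of different saddles are disjoint.** [folklore] -/
theorem eq_of_mem_chartBall_of_mem_chartBall {s s' : SaddlePt n g} {ρ ρ' : ℝ} {x : W}
    (hxb : x ∈ (Q.DA s).chartBall ρ) (hxb' : x ∈ (Q.DA s').chartBall ρ') : s = s' :=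
  Q.eq_of_mem_source_of_mem_source hxb.1 hxb'.1

end SaddleData

end BasinPair

end Literature.Topology.FourManifolds
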